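/-
Copyright (c) 2026 the pub-hodgecm-mathlib formalisation cell (harness21).  Prover seat hodgecm-mathlib-K2E1-p11 (g3), Track B ∕ K2-LIT, h413 = `stmt-HodgeConjecture-24833`,
R90-TF section S8 «ContSpec-n½», #2∕#3 road (G side), S8 dealer R90-CS-plan (g2) S8-R69 (4)(i), 2026-09-04T22:48:34Z: the XS glue reducing B ED. 5's sub-socket (R) «the middle block of
record lies in `L²_res`» to PER-LEVEL, PER-GENERATOR atom letters («residue classes are square-integrable residual: in `L²_disc`, orthogonal to `L²_cusp`», [MW95 I.2.18, V.3.13]).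
-/
import Summits.HodgeConjecture.HodgeConjecture.Theorems.R90S8ResGMidAtomU3Defs          -- ★ p862682 (K2E1-p11): `resGMidAtomGen`, `resGMidAtom ξ μω K′ ω`, `resGMidBlock ξ μω`, `resGMidBlock_le`
import Summits.HodgeConjecture.HodgeConjecture.Theorems.K2E1CuspidalSpectrumUnitaryDefs   -- ★ `residualSubspace`, `toSubmodule_residualPart`; brings ★ `discreteSpectrum`, `cuspidalSubspace`
import HarnessLib

/-!
# S8 #2∕#3 road (G side) — `R90S8ResGMidBlockLeResidualOfAtomsU3`: the middle block of record `resGMidBlock ξ μω` lies in `L²_res(U_{L/L⁺}(3), 𝔓)` AS SOON AS every level's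
# residue atom does — and an atom does as soon as its GENERATORS are in `L²_disc` and orthogonal to `L²_cusp` (sub-socket (R) reduced to per-generator letters)

Track B ∕ K2-LIT, crux h413 = `stmt-HodgeConjecture-24833`, route of record `HCCMUnconditional`; cell `hodgecm-mathlib`, R90-TF programme, section S8 «ContSpec-n½», socket #3
`sock_S8_res_piN_occurs` ∕ #2 (B ED. 4 :409 ∕ :205) and their ED. 5 sub-socket (R) of S8-R68 (at `V := resGMidBlock`).  THEOREMS ONLY (no `def`, no `instance`, no `notation`, no named-fact
hypothesis, no `sorry`; default heartbeats); lane `--supports stmt-HodgeConjecture-24833 --as helper` (count-neutral).  CLOSES NO SOCKET: it is Hilbert-space∕lattice algebra over ★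
`resGMidBlock_le` (`ClosedSubrep.generate_le`) and ★ `toSubmodule_residualPart` (`L²_res = L²_disc ⊓ (L²_cusp)ᗮ`), so that the (R) payer proves, per level `(K′, ω)` and per GENERATOR `f`
of ★ `resGMidAtomGen ξ μω K′ ω` (an `L²` class a.e. equal to a pole-letter value at `z₀ = 3/2`), the two print letters «`f ∈ L²_disc`» and «`⟪u, f⟫ = 0` for every cusp form `u`»
[MoeglinWaldspurger1995, I.2.18 «`L²_res ⊂ L²_disc`, `L²_disc = L²_cusp ⊕ L²_res`», V.3.13] — K2E1-p12 (g4) pays the cusp half (S8-R69 (4)(i)).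
* §1 `resGMidAtom_le_of_gen_subset` — an atom lies in any CLOSED submodule containing its generators (closure minimality).
* §2 `resGMidAtom_le_residualSubspace_of_disc_of_orth` (atom level: `≤ L²_disc` ∧ `≤ (L²_cusp)ᗮ` ⟹ `≤ L²_res`) and `resGMidAtom_le_residualSubspace_of_gen` (generator level).
* §3 `resGMidBlock_le_residualSubspace_of_atoms` (★ `resGMidBlock_le` at `W := L²_res`), `resGMidBlock_le_residualSubspace_of_disc_of_orth`, **`resGMidBlock_le_residualSubspace_of_gen`** (THE
  (R) INTERFACE: per-level per-generator letters ⟹ `resGMidBlock ξ μω ≤ residualSubspace (quasiSplit L⁺ L c 3) μ 𝔓`).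
HONEST LABEL: HC_CM is proved only modulo the 7 printed citations (2 remaining named inputs: hLiu418 = `stmt-HodgeConjecture-24832`, h413 = `stmt-HodgeConjecture-24833`) until rung 0
closes; REL ≠ ★ ≠ BUILT; conditional by construction on its visible binders; closes no socket; count-neutral.
-/

set_option autoImplicit false
set_option linter.dupNamespace false  -- the mandated namespace `…HodgeConjecture.HodgeConjecture.R90.S8` (LEAD #1 L1) repeats the summit's segment

noncomputable section

open MeasureTheory Measure Set NumberField
open Literature.NumberTheory.Automorphic Literature.NumberTheory.Automorphic.UnitaryGroup Literature.NumberTheory.GaloisRepresentations AdelicGroupData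
open Literature.NumberTheory.Rogawski1990
open Summit.HodgeConjecture.HodgeConjecture.Cruxes.H413.K2E1CuspidalSpectrumUnitary
open ContRepresentation
open scoped InnerProductSpace

namespace Summit.HodgeConjecture.HodgeConjecture.R90.S8

variable (L : Type) [Field L] [NumberField L] [IsCMField L]
  (μ : Measure (quasiSplit (↥(maximalRealSubfield L)) L (IsCMField.complexConj L) 3).automorphicQuotient)
  [(quasiSplit (↥(maximalRealSubfield L)) L (IsCMField.complexConj L) 3).IsAutomorphicMeasure μ]
  (ξ : OneDimAutRepH L) (μω : HeckeCharacter L)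

/-! ## §1 Closure minimality: an atom lies in any closed submodule containing its generators -/

omit [(quasiSplit (↥(maximalRealSubfield L)) L (IsCMField.complexConj L) 3).IsAutomorphicMeasure μ] in
/-- **An atom lies in any CLOSED submodule containing its generators** (`resGMidAtom = closure (span gen)`; Mathlib `Submodule.topologicalClosure_minimal`). [cite: MoeglinWaldspurger1995, V.3.13] -/
theorem resGMidAtom_le_of_gen_subset (K' : Subgroup (quasiSplit (↥(maximalRealSubfield L)) L (IsCMField.complexConj L) 3).Adelic) (ω : ↥K' →* ℂ)
    (S : Submodule ℂ ((quasiSplit (↥(maximalRealSubfield L)) L (IsCMField.complexConj L) 3).L2 μ))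
    (hS : IsClosed (S : Set ((quasiSplit (↥(maximalRealSubfield L)) L (IsCMField.complexConj L) 3).L2 μ))) (h : resGMidAtomGen L μ ξ μω K' ω ⊆ S) :
    resGMidAtom L μ ξ μω K' ω ≤ S :=
  Submodule.topologicalClosure_minimal _ (Submodule.span_le.2 h) hS

/-! ## §2 Atom level: `≤ L²_disc` and `⟂ L²_cusp` ⟹ `≤ L²_res` -/

/-- **Atom level**: if a level's atom lies in `L²_disc` and in `(L²_cusp)ᗮ`, it lies in `L²_res = L²_disc ⊓ (L²_cusp)ᗮ` (★ `toSubmodule_residualPart`). [cite: MoeglinWaldspurger1995, I.2.18] -/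
theorem resGMidAtom_le_residualSubspace_of_disc_of_orth (𝔓 : (quasiSplit (↥(maximalRealSubfield L)) L (IsCMField.complexConj L) 3).ParabolicUnipotentData)
    (K' : Subgroup (quasiSplit (↥(maximalRealSubfield L)) L (IsCMField.complexConj L) 3).Adelic) (ω : ↥K' →* ℂ)
    (hdisc : resGMidAtom L μ ξ μω K' ω ≤ ((quasiSplit (↥(maximalRealSubfield L)) L (IsCMField.complexConj L) 3).discreteSpectrum μ).toSubmodule)
    (hcusp : resGMidAtom L μ ξ μω K' ω ≤ ((quasiSplit (↥(maximalRealSubfield L)) L (IsCMField.complexConj L) 3).cuspidalSubspace μ 𝔓).toSubmoduleᗮ) :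
    resGMidAtom L μ ξ μω K' ω ≤ (residualSubspace (quasiSplit (↥(maximalRealSubfield L)) L (IsCMField.complexConj L) 3) μ 𝔓).toSubmodule := by
  rw [residualSubspace, toSubmodule_residualPart]
  exact le_inf hdisc hcusp

/-- **Generator level**: if every GENERATOR of a level's atom is in `L²_disc` and is orthogonal to every cusp form, the atom lies in `L²_res` (both targets are closed: ★ `ClosedSubrep.isClosed`,
Mathlib `Submodule.isClosed_orthogonal`). [cite: MoeglinWaldspurger1995, I.2.18, V.3.13] -/
theorem resGMidAtom_le_residualSubspace_of_gen (𝔓 : (quasiSplit (↥(maximalRealSubfield L)) L (IsCMField.complexConj L) 3).ParabolicUnipotentData)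
    (K' : Subgroup (quasiSplit (↥(maximalRealSubfield L)) L (IsCMField.complexConj L) 3).Adelic) (ω : ↥K' →* ℂ)
    (hdisc : ∀ f ∈ resGMidAtomGen L μ ξ μω K' ω, f ∈ (quasiSplit (↥(maximalRealSubfield L)) L (IsCMField.complexConj L) 3).discreteSpectrum μ)
    (hcusp : ∀ f ∈ resGMidAtomGen L μ ξ μω K' ω, ∀ u ∈ (quasiSplit (↥(maximalRealSubfield L)) L (IsCMField.complexConj L) 3).cuspidalSubspace μ 𝔓,
      ⟪(u : (quasiSplit (↥(maximalRealSubfield L)) L (IsCMField.complexConj L) 3).L2 μ), f⟫_ℂ = 0) :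
    resGMidAtom L μ ξ μω K' ω ≤ (residualSubspace (quasiSplit (↥(maximalRealSubfield L)) L (IsCMField.complexConj L) 3) μ 𝔓).toSubmodule :=
  resGMidAtom_le_residualSubspace_of_disc_of_orth L μ ξ μω 𝔓 K' ω
    (resGMidAtom_le_of_gen_subset L μ ξ μω K' ω _ (ClosedSubrep.isClosed _) fun f hf => hdisc f hf)
    (resGMidAtom_le_of_gen_subset L μ ξ μω K' ω _ (Submodule.isClosed_orthogonal _) fun f hf => (Submodule.mem_orthogonal _ f).2 fun u hu => hcusp f hf u hu)

/-! ## §3 Block level: the hull `resGMidBlock ξ μω` lies in `L²_res` — sub-socket (R) reduced to per-level, per-generator letters -/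

/-- **(R) from atom letters**: if every level's atom lies in `L²_res(𝔓)`, so does the middle block of record (★ `resGMidBlock_le`: `L²_res` is a closed invariant subspace containing the
generating set). [cite: MoeglinWaldspurger1995, I.2.18, V.3.13] -/
theorem resGMidBlock_le_residualSubspace_of_atoms (𝔓 : (quasiSplit (↥(maximalRealSubfield L)) L (IsCMField.complexConj L) 3).ParabolicUnipotentData)
    (h : ∀ (K' : Subgroup (quasiSplit (↥(maximalRealSubfield L)) L (IsCMField.complexConj L) 3).Adelic) (ω : ↥K' →* ℂ),
      resGMidAtom L μ ξ μω K' ω ≤ (residualSubspace (quasiSplit (↥(maximalRealSubfield L)) L (IsCMField.complexConj L) 3) μ 𝔓).toSubmodule) :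
    resGMidBlock L μ ξ μω ≤ residualSubspace (quasiSplit (↥(maximalRealSubfield L)) L (IsCMField.complexConj L) 3) μ 𝔓 :=
  resGMidBlock_le L μ ξ μω _ h

/-- **(R) from the two atom-level letters** `≤ L²_disc` and `≤ (L²_cusp)ᗮ` at every level. [cite: MoeglinWaldspurger1995, I.2.18] -/
theorem resGMidBlock_le_residualSubspace_of_disc_of_orth (𝔓 : (quasiSplit (↥(maximalRealSubfield L)) L (IsCMField.complexConj L) 3).ParabolicUnipotentData)
    (hdisc : ∀ (K' : Subgroup (quasiSplit (↥(maximalRealSubfield L)) L (IsCMField.complexConj L) 3).Adelic) (ω : ↥K' →* ℂ),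
      resGMidAtom L μ ξ μω K' ω ≤ ((quasiSplit (↥(maximalRealSubfield L)) L (IsCMField.complexConj L) 3).discreteSpectrum μ).toSubmodule)
    (hcusp : ∀ (K' : Subgroup (quasiSplit (↥(maximalRealSubfield L)) L (IsCMField.complexConj L) 3).Adelic) (ω : ↥K' →* ℂ),
      resGMidAtom L μ ξ μω K' ω ≤ ((quasiSplit (↥(maximalRealSubfield L)) L (IsCMField.complexConj L) 3).cuspidalSubspace μ 𝔓).toSubmoduleᗮ) :
    resGMidBlock L μ ξ μω ≤ residualSubspace (quasiSplit (↥(maximalRealSubfield L)) L (IsCMField.complexConj L) 3) μ 𝔓 :=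
  resGMidBlock_le_residualSubspace_of_atoms L μ ξ μω 𝔓 fun K' ω => resGMidAtom_le_residualSubspace_of_disc_of_orth L μ ξ μω 𝔓 K' ω (hdisc K' ω) (hcusp K' ω)

/-- **THE (R) INTERFACE — per-level, per-GENERATOR letters ⟹ `resGMidBlock ξ μω ≤ L²_res(𝔓)`**: the (R) payer shows, for every level `(K′, ω)` and every generator `f` (an `L²` class a.e.
equal to a pole-letter value at `z₀ = 3/2` of the continued Eisenstein family of a section of the `φ_ξ`-block), that `f ∈ L²_disc` and `⟪u, f⟫ = 0` for every cusp form `u` — the print's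
«residues of Eisenstein series are square-integrable, discrete and orthogonal to the cusp forms» — and (R) follows. [cite: MoeglinWaldspurger1995, I.2.18, V.3.13] [cite: Rogawski1990, §13.9 p. 229 (ii)] -/
theorem resGMidBlock_le_residualSubspace_of_gen (𝔓 : (quasiSplit (↥(maximalRealSubfield L)) L (IsCMField.complexConj L) 3).ParabolicUnipotentData)
    (hdisc : ∀ (K' : Subgroup (quasiSplit (↥(maximalRealSubfield L)) L (IsCMField.complexConj L) 3).Adelic) (ω : ↥K' →* ℂ),
      ∀ f ∈ resGMidAtomGen L μ ξ μω K' ω, f ∈ (quasiSplit (↥(maximalRealSubfield L)) L (IsCMField.complexConj L) 3).discreteSpectrum μ)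
    (hcusp : ∀ (K' : Subgroup (quasiSplit (↥(maximalRealSubfield L)) L (IsCMField.complexConj L) 3).Adelic) (ω : ↥K' →* ℂ),
      ∀ f ∈ resGMidAtomGen L μ ξ μω K' ω, ∀ u ∈ (quasiSplit (↥(maximalRealSubfield L)) L (IsCMField.complexConj L) 3).cuspidalSubspace μ 𝔓,
        ⟪(u : (quasiSplit (↥(maximalRealSubfield L)) L (IsCMField.complexConj L) 3).L2 μ), f⟫_ℂ = 0) :
    resGMidBlock L μ ξ μω ≤ residualSubspace (quasiSplit (↥(maximalRealSubfield L)) L (IsCMField.complexConj L) 3) μ 𝔓 :=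
  resGMidBlock_le_residualSubspace_of_atoms L μ ξ μω 𝔓 fun K' ω => resGMidAtom_le_residualSubspace_of_gen L μ ξ μω 𝔓 K' ω (hdisc K' ω) (hcusp K' ω)

end Summit.HodgeConjecture.HodgeConjecture.R90.S8

end
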